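import Literature.IUT.HodgeArakelov.GMonoidFrobenioidsEquivariant
import Literature.AlgebraicGeometry.Frobenioids.ModelFrobenioidBaseChangeEquivalence
import Literature.AlgebraicGeometry.Frobenioids.ElementaryPreFrobenioid
import Literature.AlgebraicGeometry.Frobenioids.ElementaryFrobeniusCompact
import HarnessLib

/-!
# [IUTchII] Definition 3.8 (i): an ISOMORPHISM of `G`-monoids induces an EQUIVALENCE of model Frobenioids
# (the inverse laws behind «the isomorphism of monoids … may be interpreted as an isomorphism of Frobenioids»)

S. Mochizuki, *Inter-universal Teichmüller theory II*, §3, kurims manuscript (Dec. 2020), Definition 3.8 (i)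
p. 112 l. 47 – p. 113 l. 57 [cite: Mochizuki2012, Def 3.8 (i) p.113] (pages = kurims preprint render
IUTchII-kurims-url-5036b4059555; D-0012 claim key, status disputed — nothing of the series is asserted): «… equipped
with natural isomorphisms `F_cns(M^Θ_*) ⥲ F_cns(M^Θ_*(†F_v)) ⥲ F_cns(†F_v)`, `F_{†C_v} ⥲ †C_v`, i.e. the isomorphism of
monoids of Proposition 3.3, (ii), may be interpreted as an isomorphism of Frobenioids `†C_v ⥲ F_cns(M^Θ_*)`»; (ii)
p. 113 l. 58 – p. 114 l. 77 «isomorphisms of split Frobenioids `F_{†F^Θ_v,α} ⥲ F^ι_env(M^Θ_*)`».  S. Mochizuki, *The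
geometry of Frobenioids I*, Kyushu J. Math. **62** (2008), Cor. 5.4 p. 104 («the horizontal arrows are equivalences
of categories») [cite: MochizukiFrdI2008, Cor. 5.4 p.104].

abc-iut cell, MERGE-MAP register row **R-Def38-a** (plan/L6/MERGE-MAP.md §8S), seat abc-iut-L6-t7 (the register's
writer), gen 5.  The gen-4 file `GMonoidFrobenioidsEquivariant` (p457393) constructs, for a `G`-EQUIVARIANT
homomorphism `φ : Ψ → Ψ'` of `G`-monoids, the functor of model Frobenioids `frobenioidMap φ : F(G ↷ Ψ) ⥤ F(G ↷ Ψ')`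
(abc-iut-L1's `DataHom.functor`, [FrdI] Prop. 5.3) and records «an equivariant ISOMORPHISM `Ψ ≅ Ψ'` gives
`frobenioidMap` both ways (the inverse laws are (B)'s to state)».  THIS FILE states and proves those inverse laws in
the strongest form, PROOF-ONLY (0 `def`, 0 `instance`, 0 `Prop`-valued definition), over FROZEN vocabulary consumed
BY NAME (abc-iut-w4-d019 `CoveringMonoid.*` p455796; abc-iut-L6-t7 gen 4 `invariantsHom` / `dataHomOfEquivariant` /
`frobenioidMap` / `ThetaEnvData.frobenioidMapOfLE` p457393; abc-iut-w5-d048 / w5-d137 `ModelFrobenioid.DataHomOver`,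
`DataHomOver.functor_isEquivalence` ([FrdI] Cor. 5.4); abc-iut-L1 `associatesMap_injective_of_bijective`,
`associatesMap_surjective`, `gpMap_bijective_of_bijective`):

* `dataHom_functor_isEquivalence_of_bijective` — [FrdI] Cor. 5.4 over the IDENTITY of the base: abc-iut-L1's
  `DataHom.functor` of a morphism of model data with bijective components `η`, `β` is an equivalence (abc-iut-w5-d137's
  `DataHomOver.functor_isEquivalence` at `𝟭 D` — a `DataHom` is a `DataHomOver (𝟭 D)` and base change along `𝟭 D`
  is the identity, both definitionally; usable by ANY same-base comparison, e.g. MERGE-MAP B16 δ2);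
* `CoveringMonoid.symm_equivariant` — the inverse of an equivariant isomorphism is equivariant;
* `invariantsHom_injective / _surjective / _bijective` — on `U`-invariants an equivariant isomorphism `e : Ψ ≃* Ψ'`
  restricts to bijections `Ψ^U ≃ Ψ'^U`;
* `eta_app_bijective` (divisor monoids `Φ(G/U) = Ψ^U/(Ψ^U)^× → Ψ'^U/(Ψ'^U)^×`) and `beta_app_bijective`
  (rational-function monoids `B(G/U) = (Ψ^U)^gp → (Ψ'^U)^gp`) — the components of the model-data morphism
  `dataHomOfEquivariant e` are bijective;
* **`frobenioidMap_isEquivalence`** — `frobenioidMap e : F(G ↷ Ψ) ⥤ F(G ↷ Ψ')` IS AN EQUIVALENCE OF CATEGORIES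
  (it is abc-iut-w5-d048's `DataHomOver.functor` over the identity of the base `𝓑(G)⁰ = CosetCat G` ON THE NOSE, so
  abc-iut-w5-d137's [FrdI] Cor. 5.4 criterion applies); `frobenioidMap_faithful / _full / _essSurj`;
  `nonempty_frobenioid_equivalence` (`F(G ↷ Ψ) ≌ F(G ↷ Ψ')`);
* at abc-iut-L6-t2's [IUTchII] Prop 3.1 data `E : ThetaEnvData P`: **`ThetaEnvData.frobenioidMapOfLE_isEquivalence`**
  — for `Q`-stable submonoids `S ≤ S' ≤ S` of `lim_J H¹(…)` (two presentations of the SAME monoid, e.g. abc-iut-L6-t2's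
  `Ψ^ι_env(M^Θ_*)` and abc-iut-w4-d019's `M^×_TM·θ^ℕ` once `thetaMonoid_eq_splitMonoid_powers` p411833 identifies them)
  the functor `F(Q ↷ S) ⥤ F(Q ↷ S')` is an equivalence; `nonempty_frobenioidOfStable_equivalence_of_eq`.

HONEST LIMITS: (1) same acting group `G` on both sides — an isomorphism of PAIRS `(G ↷ Ψ) ⥲ (G' ↷ Ψ')` over a
group isomorphism `G ≅ G'` lies over the induced equivalence of bases `𝓑(G)⁰ ≌ 𝓑(G')⁰` (abc-iut-L5-t2's
`CosetCat.pull_isEquivalence_of_injective`) and is NOT treated here (register row R-Def38-a, item «PAIR-ISO»);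
(2) nothing here identifies the monoid-level `F_cns` with the field-level referent at the genuine producers (MERGE-MAP
B16, abc-iut-L5-t2's δ2); (3) equivalence, not a chosen inverse functor (no data is introduced).  No sorry; typed ≠
proved elsewhere; nothing here bears on [IUTchIII] Cor. 3.12; nothing asserts abc proved or refuted.
-/

noncomputable section

namespace Literature.IUT.HodgeArakelov

open CategoryTheory Opposite Function
open Literature.AlgebraicGeometry.Frobenioids Literature.AnabelianGeometry.SemiGraphs

universe u v

/-! ### 0. [FrdI] Cor. 5.4 over the identity of the base: a morphism of model data with bijective components
induces an equivalence of model Frobenioids -/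

section Generic

universe w v₁ u₁

variable {D : Type u₁} [Category.{v₁} D] {Φ B Φ' B' : Dᵒᵖ ⥤ CommMonCat.{w}}
  {DivB : B ⟶ monoidGp Φ} {DivB' : B' ⟶ monoidGp Φ'}

/-- **[FrdI] Cor. 5.4 over the identity of the base.** A morphism of model data `(Φ, B, Div_B) → (Φ', B', Div_B')`
on ONE base `D` (abc-iut-L1's `ModelFrobenioid.DataHom`) whose components `η_A : Φ(A) → Φ'(A)` and `β_A : B(A) → B'(A)`
are bijective induces an EQUIVALENCE of model Frobenioids `DataHom.functor`.  This is abc-iut-w5-d137's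
`DataHomOver.functor_isEquivalence` at the base functor `𝟭 D`: a `DataHom` IS a `DataHomOver (𝟭 D)` and its
`DataHomOver.functor` IS `DataHom.functor`, both definitionally (base change along `𝟭 D` is the identity).
[cite: MochizukiFrdI2008, Cor. 5.4 p.104] -/
theorem dataHom_functor_isEquivalence_of_bijective (h : ModelFrobenioid.DataHom DivB DivB')
    (hη : ∀ X : D, Bijective (h.η.app (op X)).hom) (hβ : ∀ X : D, Bijective (h.β.app (op X)).hom) :
    h.functor.IsEquivalence :=
  ModelFrobenioid.DataHomOver.functor_isEquivalence (G := 𝟭 D) (h : ModelFrobenioid.DataHomOver (𝟭 D) DivB DivB')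
    hη hβ

end Generic

namespace CoveringMonoid

variable {G : Type u} [Group G] {M M' : CoveringMonoid.{u, v} G}
  (e : M.O ≃* M'.O) (he : ∀ (g : G) (x : M.O), e (M.act g x) = M'.act g (e x))

/-! ### 1. Equivariant isomorphisms of `G`-monoids: bijectivity on invariants, divisor and rational-function monoids -/

include he in
/-- The inverse of a `G`-equivariant isomorphism of monoids is `G`-equivariant. [cite: Mochizuki2012, Def 3.8 (i) p.113] -/
theorem symm_equivariant (g : G) (y : M'.O) : e.symm (M'.act g y) = M.act g (e.symm y) := by
  apply e.injective
  rw [e.apply_symm_apply, he, e.apply_symm_apply]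

/-- On `U`-invariants an equivariant isomorphism is injective. [cite: Mochizuki2012, Def 3.8 (i) p.113] -/
theorem invariantsHom_injective (U : Subgroup G) : Injective (invariantsHom (e : M.O →* M'.O) he U) := by
  intro x y h
  apply Subtype.ext
  exact e.injective (congrArg Subtype.val h)

/-- On `U`-invariants an equivariant isomorphism is surjective: the preimage `e⁻¹ y` of a `U`-invariant `y` is
`U`-invariant (equivariance of `e⁻¹`). [cite: Mochizuki2012, Def 3.8 (i) p.113] -/
theorem invariantsHom_surjective (U : Subgroup G) : Surjective (invariantsHom (e : M.O →* M'.O) he U) := by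
  intro y
  refine ⟨⟨e.symm y, map_mem_invariants (M := M') (M' := M) (e.symm : M'.O →* M.O) (symm_equivariant e he) y.2⟩,
    Subtype.ext ?_⟩
  change e (e.symm (y : M'.O)) = (y : M'.O)
  exact e.apply_symm_apply _

/-- On `U`-invariants an equivariant isomorphism is bijective, `Ψ^U ≃ Ψ'^U`. [cite: Mochizuki2012, Def 3.8 (i) p.113] -/
theorem invariantsHom_bijective (U : Subgroup G) : Bijective (invariantsHom (e : M.O →* M'.O) he U) :=
  ⟨invariantsHom_injective e he U, invariantsHom_surjective e he U⟩

variable [TopologicalSpace G]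

/-- The divisor-monoid component `η_{G/U} : Ψ^U/(Ψ^U)^× → Ψ'^U/(Ψ'^U)^×` of the model-data morphism of an equivariant
isomorphism is bijective (characteristic of a bijection: abc-iut-L1's `associatesMap_injective_of_bijective`,
`associatesMap_surjective`). [cite: Mochizuki2012, Def 3.8 (i) p.113] -/
theorem eta_app_bijective (X : CosetCat G) :
    Bijective ((dataHomOfEquivariant (e : M.O →* M'.O) he).η.app (op X)).hom :=
  ⟨associatesMap_injective_of_bijective (invariantsHom_bijective e he _),
    associatesMap_surjective (invariantsHom_surjective e he _)⟩

/-- The rational-function-monoid component `β_{G/U} : (Ψ^U)^gp → (Ψ'^U)^gp` of the model-data morphism of an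
equivariant isomorphism is bijective (groupification of a bijection: abc-iut-L1's `gpMap_bijective_of_bijective`).
[cite: Mochizuki2012, Def 3.8 (i) p.113] -/
theorem beta_app_bijective (X : CosetCat G) :
    Bijective ((dataHomOfEquivariant (e : M.O →* M'.O) he).β.app (op X)).hom :=
  gpMap_bijective_of_bijective _ (invariantsHom_bijective e he _)

/-! ### 2. The induced functor of model Frobenioids is an equivalence ([FrdI] Cor. 5.4 over the identity of `𝓑(G)⁰`) -/

/-- **«The isomorphism of monoids … may be interpreted as an isomorphism of Frobenioids»** (Def 3.8 (i)), inverse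
laws included: for a `G`-equivariant ISOMORPHISM `e : Ψ ≃* Ψ'` the induced functor of model Frobenioids
`frobenioidMap e : F(G ↷ Ψ) ⥤ F(G ↷ Ψ')` is an EQUIVALENCE of categories — it is the functor of [FrdI] Thm 5.2 (i)'s
construction induced by a morphism of model data over the identity of the base with bijective components, so [FrdI]
Cor. 5.4's criterion (abc-iut-w5-d137 `DataHomOver.functor_isEquivalence`) applies. [cite: Mochizuki2012, Def 3.8 (i) p.113] -/
theorem frobenioidMap_isEquivalence : (frobenioidMap (e : M.O →* M'.O) he).IsEquivalence :=
  dataHom_functor_isEquivalence_of_bijective (dataHomOfEquivariant (e : M.O →* M'.O) he)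
    (eta_app_bijective e he) (beta_app_bijective e he)

/-- `frobenioidMap e` is faithful. [cite: Mochizuki2012, Def 3.8 (i) p.113] -/
theorem frobenioidMap_faithful : (frobenioidMap (e : M.O →* M'.O) he).Faithful :=
  haveI := frobenioidMap_isEquivalence e he
  inferInstance

/-- `frobenioidMap e` is full. [cite: Mochizuki2012, Def 3.8 (i) p.113] -/
theorem frobenioidMap_full : (frobenioidMap (e : M.O →* M'.O) he).Full :=
  haveI := frobenioidMap_isEquivalence e he
  inferInstance

/-- `frobenioidMap e` is essentially surjective. [cite: Mochizuki2012, Def 3.8 (i) p.113] -/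
theorem frobenioidMap_essSurj : (frobenioidMap (e : M.O →* M'.O) he).EssSurj :=
  haveI := frobenioidMap_isEquivalence e he
  inferInstance

include he in
/-- The model Frobenioids of equivariantly isomorphic `G`-monoids are equivalent categories:
`F(G ↷ Ψ) ≌ F(G ↷ Ψ')`. [cite: Mochizuki2012, Def 3.8 (i) p.113] -/
theorem nonempty_frobenioid_equivalence : Nonempty (M.frobenioid ≌ M'.frobenioid) :=
  haveI := frobenioidMap_isEquivalence e he
  ⟨(frobenioidMap (e : M.O →* M'.O) he).asEquivalence⟩

/-- The equivalence lies over the identity of the base: `frobenioidMap e ⋙ (→ 𝓑(G)⁰) = (→ 𝓑(G)⁰)`.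
[cite: Mochizuki2012, Def 3.8 (i) p.113] -/
theorem frobenioidMap_comp_baseFunctor :
    frobenioidMap (e : M.O →* M'.O) he ⋙ ModelFrobenioid.baseFunctor M'.divisorFunctor M'.ratFnFunctor M'.divB =
      ModelFrobenioid.baseFunctor M.divisorFunctor M.ratFnFunctor M.divB := rfl

end CoveringMonoid

/-! ### 3. [IUTchII] §3: two presentations of the same stable monoid give equivalent Frobenioids -/

namespace TemperedThetaMonoids.ThetaEnvData

variable {P : Type u} [Group P] [TopologicalSpace P] (E : ThetaEnvData.{u, v} P)

/-- For `Q`-stable submonoids `S ≤ S'` AND `S' ≤ S` of `lim_J H¹(…)` — two presentations of the same monoid with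
`Q`-action, e.g. `Ψ^ι_env(M^Θ_*)` (abc-iut-L6-t2) and `M^×_TM·θ^ℕ` (abc-iut-w4-d019, `thetaMonoid_eq_splitMonoid_powers`)
— the functor `F(Q ↷ S) ⥤ F(Q ↷ S')` of Def 3.8 (ii)'s Frobenioids (`frobenioidMapOfLE`) is an equivalence of
categories. [cite: Mochizuki2012, Def 3.8 (ii) p.113] -/
theorem frobenioidMapOfLE_isEquivalence {S S' : Submonoid E.H} {Q : Subgroup P}
    (hS : ∀ (g : Q) (x : E.H), x ∈ S → E.conj g x ∈ S) (hS' : ∀ (g : Q) (x : E.H), x ∈ S' → E.conj g x ∈ S')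
    (hle : S ≤ S') (hge : S' ≤ S) : (E.frobenioidMapOfLE hS hS' hle).IsEquivalence := by
  let e : (E.coveringOfStable S Q hS).O ≃* (E.coveringOfStable S' Q hS').O :=
    MulEquiv.ofBijective (Submonoid.inclusion hle)
      ⟨Submonoid.inclusion_injective hle, fun y => ⟨⟨y.1, hge y.2⟩, Subtype.ext rfl⟩⟩
  exact CoveringMonoid.frobenioidMap_isEquivalence (M := E.coveringOfStable S Q hS)
    (M' := E.coveringOfStable S' Q hS') e fun _ _ => rfl

/-- Equal `Q`-stable submonoids (with possibly different stability witnesses) have equivalent Frobenioids.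
[cite: Mochizuki2012, Def 3.8 (ii) p.113] -/
theorem nonempty_frobenioidOfStable_equivalence_of_eq {S S' : Submonoid E.H} {Q : Subgroup P}
    (hS : ∀ (g : Q) (x : E.H), x ∈ S → E.conj g x ∈ S) (hS' : ∀ (g : Q) (x : E.H), x ∈ S' → E.conj g x ∈ S')
    (h : S = S') : Nonempty (E.frobenioidOfStable S Q hS ≌ E.frobenioidOfStable S' Q hS') :=
  haveI := E.frobenioidMapOfLE_isEquivalence hS hS' h.le h.ge
  ⟨(E.frobenioidMapOfLE hS hS' h.le).asEquivalence⟩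

end TemperedThetaMonoids.ThetaEnvData

end Literature.IUT.HodgeArakelov

end
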